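import Literature.NumberTheory.LFunctions.Zhang2022.ObjectiveTwinDetEdgeFamily

/-!
# Zhang (2022) design-space objective, twin part 18f: the EDGE family for every `(J, w)` — sign, non-PSD of every
# edge recipe, the uniform bound by the `J → ∞` value, and the limit `−4(1 − cos πw) − 2πw·sin πw`

Y. Zhang, *Discrete mean estimates and the Landau–Siegel zero*, arXiv:2211.02515v1 (2022)
[Zhang2022LandauSiegel] — an unrefereed manuscript under adjudication. **This file SEARCHES and TYPES; it
makes no claim about Landau–Siegel zeros, about Theorems 1–2 of the manuscript, or about a repaired (2.32),
until a kernel theorem says so.** LANDAU–SIEGEL programme, cell `landau-siegel`, §A Lean twin serving §D (edge ell).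

Part 18e (`ObjectiveTwinDetEdgeFamily`) gave, for every real half-width `0 < w < 1` and every `J`, the closed form of
formula I of the edge recipe `shiftRecipe (1, J−w, J+w)` on the two-term witness `k₁ + (−1)^J k_J`
(`Det.formDet_edgeFamily_even/odd`). This part draws the consequences the numerics lineages and the §D referee
stated in prose (cell INBOX 2026-08-27T02:03:22Z ls-Bmulti-num-1 g4, 02:07:54Z ls-ref-1 g2: «limits
−4(1−cos πw) − 2wπ sin πw = −2.28229/−5.1539…/−7.1416»). With `L(w) := −4(1 − cos πw) − 2πw·sin πw`:

* `Det.edgeLimit_neg` — `L(w) < 0` for `0 < w < 1`;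
* `Det.formDet_edgeFamily` — the parity-uniform closed form for every `J ≥ 2` (odd/even corrections merged by
  the factor `(1 − (−1)^J)/2`);
* `Det.formDet_edgeFamily_le_limit` — **uniform bound** `FormDet ≤ L(w)` for every `J ≥ 2` (both finite-`J`
  corrections have denominators `J(J−1−w)(J−1+w) > 0`, so they only deepen the value);
* `Det.formDet_edgeFamily_neg`, `Det.not_formDetPSD_edgeFamily` — every edge value is negative, so NO edge recipe
  `shiftRecipe (1, J−w, J+w)` (`J ≥ 2`, `0 < w < 1`) is PSD in formula I on one-sided kinked profiles — the whole
  two-parameter edge family of the vernier books, not only its tabulated members (parts 16, 18b–18e);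
* `Det.tendsto_formDet_edgeFamily` — the edge values converge to `L(w)` as `J → ∞` (corrections `O(1/J)`), with
  the instances `w = ½` (`−(4+π)`, part 18c's `tendsto_formDet_fullGapEdge` in recipe form) and `w = ¼`
  (`−4 + 2√2 − √2π/4`, stated without proof in part 18d's docstring) and decimal brackets.

SCOPE (unchanged): `b₀ = 1` is the INADMISSIBLE edge (near shift on the model zero; `(1, J−w, J+w)` is not
sign-admissible: `σ_b(−J) = J(J−1)·(−w²) < 0`); nothing here concerns admissible designs or any word of record.
Theorems only; no new definitions; elementary real analysis on part 18e's closed forms.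
-/

noncomputable section

open Complex Real ComplexConjugate Filter Topology

namespace Literature.NumberTheory.LFunctions.Zhang2022

namespace Det

open Repair Objective

/-! ## The limit value and the denominators -/

/-- The `J → ∞` edge value `L(w) = −4(1 − cos πw) − 2πw·sin πw` is NEGATIVE for `0 < w < 1`
(`0 < πw < π`: `cos πw ≤ 1`, `sin πw > 0`) — the sign of the `J → ∞` value of formula I of the edge recipes
`shiftRecipe (1, J−w, J+w)` on `k₁ + (−1)^J k_J`. [cite: Zhang2022LandauSiegel, Prop 7.1 p.44; §2 (2.13)] -/
theorem edgeLimit_neg {w : ℝ} (hw0 : 0 < w) (hw1 : w < 1) :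
    -4 * (1 - Real.cos (π * w)) - 2 * w * π * Real.sin (π * w) < 0 := by
  have hπw0 : 0 < π * w := mul_pos Real.pi_pos hw0
  have hπw1 : π * w < π := by nlinarith [Real.pi_pos]
  have hs : 0 < Real.sin (π * w) := Real.sin_pos_of_pos_of_lt_pi hπw0 hπw1
  have hc : Real.cos (π * w) ≤ 1 := Real.cos_le_one _
  nlinarith [mul_pos (mul_pos hw0 Real.pi_pos) hs]

/-- Positivity of the denominators of the finite-`J` corrections for `J ≥ 2`, `0 < w < 1`. [folklore] -/
private theorem edge_denom_pos {J : ℕ} (hJ : 2 ≤ J) {w : ℝ} (hw0 : 0 < w) (hw1 : w < 1) :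
    0 < (J : ℝ) * ((J : ℝ) - 1 - w) * ((J : ℝ) - 1 + w) ∧
      0 < (J : ℝ) ^ 2 * ((J : ℝ) - 1 - w) * ((J : ℝ) - 1 + w) := by
  have hJ' : (2 : ℝ) ≤ J := by exact_mod_cast hJ
  have h1 : (0 : ℝ) < (J : ℝ) - 1 - w := by linarith
  have h2 : (0 : ℝ) < (J : ℝ) - 1 + w := by linarith
  have hJ0 : (0 : ℝ) < J := by linarith
  exact ⟨by positivity, by positivity⟩

/-! ## The parity-uniform closed form and the uniform bound -/

/-- The parity-uniform closed form of the edge value for `J ≥ 2`: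
`FormDet (shiftRecipe (1, J−w, J+w)) (k₁ + (−1)^J k_J)
 = −4(1 − cos πw)·(1 + [(1−(−1)^J)/2]·(2J−1)w²/(J²(J−1−w)(J−1+w))) − 2wπ sin πw·(1 + w²/(J(J−1−w)(J−1+w)))`
(= `formDet_edgeFamily_even` / `_odd` of part 18e according to the parity of `J`).
[cite: Zhang2022LandauSiegel, Prop 7.1 p.44 with (8.11)–(8.23); §2 (2.13)] -/
theorem formDet_edgeFamily {J : ℕ} (hJ : 2 ≤ J) {w : ℝ} (hw0 : 0 < w) (hw1 : w < 1) :
    FormDet (shiftRecipe ![1, (J : ℝ) - w, (J : ℝ) + w])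
        (fun y => (1:ℂ) * afeDir 1 y + ((-1 : ℂ) ^ J) * afeDir J y)
        (fun y => (1:ℂ) * afeDir' 1 y + ((-1 : ℂ) ^ J) * afeDir' J y) =
      -4 * (1 - Real.cos (π * w)) *
          (1 + (1 - (-1 : ℝ) ^ J) / 2 *
            ((2 * J - 1) * w ^ 2 / ((J : ℝ) ^ 2 * ((J : ℝ) - 1 - w) * ((J : ℝ) - 1 + w))))
        - 2 * w * π * Real.sin (π * w) * (1 + w ^ 2 / ((J : ℝ) * ((J : ℝ) - 1 - w) * ((J : ℝ) - 1 + w))) := by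
  rcases Nat.even_or_odd J with he | ho
  · rw [show ((-1 : ℂ) ^ J) = 1 from he.neg_one_pow, show ((-1 : ℝ) ^ J) = 1 from he.neg_one_pow,
      formDet_edgeFamily_even he hJ hw0 hw1]
    ring
  · have hJ3 : 3 ≤ J := by
      rcases ho with ⟨k, hk⟩
      omega
    rw [show ((-1 : ℂ) ^ J) = -1 from ho.neg_one_pow, show ((-1 : ℝ) ^ J) = -1 from ho.neg_one_pow,
      formDet_edgeFamily_odd ho hJ3 hw0 hw1]
    ring

/-- **UNIFORM BOUND**: for every `J ≥ 2` and `0 < w < 1` the edge value is at most its `J → ∞` value,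
`FormDet (shiftRecipe (1, J−w, J+w)) (k₁ + (−1)^J k_J) ≤ −4(1 − cos πw) − 2πw·sin πw` (both finite-`J`
corrections are non-negative multiples of non-positive quantities). [cite: Zhang2022LandauSiegel, Prop 7.1 p.44; §2 (2.13)] -/
theorem formDet_edgeFamily_le_limit {J : ℕ} (hJ : 2 ≤ J) {w : ℝ} (hw0 : 0 < w) (hw1 : w < 1) :
    FormDet (shiftRecipe ![1, (J : ℝ) - w, (J : ℝ) + w])
        (fun y => (1:ℂ) * afeDir 1 y + ((-1 : ℂ) ^ J) * afeDir J y)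
        (fun y => (1:ℂ) * afeDir' 1 y + ((-1 : ℂ) ^ J) * afeDir' J y) ≤
      -4 * (1 - Real.cos (π * w)) - 2 * w * π * Real.sin (π * w) := by
  rw [formDet_edgeFamily hJ hw0 hw1]
  obtain ⟨hD1, hD2⟩ := edge_denom_pos hJ hw0 hw1
  have hJ' : (2 : ℝ) ≤ J := by exact_mod_cast hJ
  have hπw0 : 0 < π * w := mul_pos Real.pi_pos hw0
  have hπw1 : π * w < π := by nlinarith [Real.pi_pos]
  have hs : 0 ≤ Real.sin (π * w) := (Real.sin_pos_of_pos_of_lt_pi hπw0 hπw1).le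
  have hc : 0 ≤ 1 - Real.cos (π * w) := by linarith [Real.cos_le_one (π * w)]
  have hpar : 0 ≤ (1 - (-1 : ℝ) ^ J) / 2 := by
    rcases neg_one_pow_eq_or ℝ J with h | h <;> rw [h] <;> norm_num
  have hA : 0 ≤ (1 - (-1 : ℝ) ^ J) / 2 *
      ((2 * J - 1) * w ^ 2 / ((J : ℝ) ^ 2 * ((J : ℝ) - 1 - w) * ((J : ℝ) - 1 + w))) :=
    mul_nonneg hpar (div_nonneg (mul_nonneg (by linarith) (sq_nonneg w)) hD2.le)
  have hB : 0 ≤ w ^ 2 / ((J : ℝ) * ((J : ℝ) - 1 - w) * ((J : ℝ) - 1 + w)) :=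
    div_nonneg (sq_nonneg w) hD1.le
  have hws : 0 ≤ 2 * w * π * Real.sin (π * w) := by
    have := mul_pos hw0 Real.pi_pos
    positivity
  nlinarith [mul_nonneg (mul_nonneg (by norm_num : (0:ℝ) ≤ 4) hc) hA, mul_nonneg hws hB]

/-! ## Sign and non-PSD for every `(J, w)` -/

/-- **SIGN**: every edge value is NEGATIVE (`J ≥ 2`, `0 < w < 1`). [cite: Zhang2022LandauSiegel, Prop 7.1 p.44; §2 (2.13)] -/
theorem formDet_edgeFamily_neg {J : ℕ} (hJ : 2 ≤ J) {w : ℝ} (hw0 : 0 < w) (hw1 : w < 1) :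
    FormDet (shiftRecipe ![1, (J : ℝ) - w, (J : ℝ) + w])
        (fun y => (1:ℂ) * afeDir 1 y + ((-1 : ℂ) ^ J) * afeDir J y)
        (fun y => (1:ℂ) * afeDir' 1 y + ((-1 : ℂ) ^ J) * afeDir' J y) < 0 :=
  (formDet_edgeFamily_le_limit hJ hw0 hw1).trans_lt (edgeLimit_neg hw0 hw1)

/-- **NO EDGE RECIPE IS PSD**: for every `J ≥ 2` and every `0 < w < 1`, formula I of `shiftRecipe (1, J−w, J+w)`
is negative on the one-sided kinked profile `k₁ + (−1)^J k_J` (which vanishes at `y = 1`), hence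
`¬ FormDetPSD (shiftRecipe (1, J−w, J+w))` — the whole two-parameter EDGE family of the §D vernier books
(near shift ON the model zero, far pair symmetric about an integer), not only its tabulated members.
[cite: Zhang2022LandauSiegel, Prop 7.1 p.44; §2 (2.13), Lemma 2.3 p.6] -/
theorem not_formDetPSD_edgeFamily {J : ℕ} (hJ : 2 ≤ J) {w : ℝ} (hw0 : 0 < w) (hw1 : w < 1) :
    ¬ FormDetPSD (shiftRecipe ![1, (J : ℝ) - w, (J : ℝ) + w]) := by
  intro h
  have hsq : ((-1 : ℂ) ^ J) * (-1) ^ J = 1 := by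
    rw [← mul_pow]; norm_num
  have hu1 : (fun y : ℝ => (1:ℂ) * afeDir 1 y + ((-1 : ℂ) ^ J) * afeDir J y) 1 = 0 := by
    simp only [afeDir_one, pow_one, one_mul, hsq]
    norm_num
  have hv := h _ _ (kinkedProfile_twoTerm 1 J 1 ((-1 : ℂ) ^ J)) hu1
  linarith [formDet_edgeFamily_neg hJ hw0 hw1]

/-! ## The limit `J → ∞` -/

/-- **THE LIMIT**: along `J → ∞` the edge values `FormDet (shiftRecipe (1, J−w, J+w)) (k₁ + (−1)^J k_J)` tend to
`L(w) = −4(1 − cos πw) − 2πw·sin πw` (the finite-`J` corrections are `O(1/J)`: for `J ≥ 3`,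
`w²/(J(J−1−w)(J−1+w)) ≤ w²/J` and `(2J−1)w²/(J²(J−1−w)(J−1+w)) ≤ 2w²/J`).
[cite: Zhang2022LandauSiegel, Prop 7.1 p.44; §2 (2.13)] -/
theorem tendsto_formDet_edgeFamily {w : ℝ} (hw0 : 0 < w) (hw1 : w < 1) :
    Tendsto (fun J : ℕ => FormDet (shiftRecipe ![1, (J : ℝ) - w, (J : ℝ) + w])
        (fun y => (1:ℂ) * afeDir 1 y + ((-1 : ℂ) ^ J) * afeDir J y)
        (fun y => (1:ℂ) * afeDir' 1 y + ((-1 : ℂ) ^ J) * afeDir' J y))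
      atTop (𝓝 (-4 * (1 - Real.cos (π * w)) - 2 * w * π * Real.sin (π * w))) := by
  set c : ℝ := -4 * (1 - Real.cos (π * w)) with hc
  set d : ℝ := 2 * w * π * Real.sin (π * w) with hd
  set A : ℕ → ℝ := fun J => (1 - (-1 : ℝ) ^ J) / 2 *
      ((2 * J - 1) * w ^ 2 / ((J : ℝ) ^ 2 * ((J : ℝ) - 1 - w) * ((J : ℝ) - 1 + w))) with hA
  set B : ℕ → ℝ := fun J => w ^ 2 / ((J : ℝ) * ((J : ℝ) - 1 - w) * ((J : ℝ) - 1 + w)) with hB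
  -- `B → 0`
  have hBt : Tendsto B atTop (𝓝 0) := by
    have hb : Tendsto (fun J : ℕ => w ^ 2 / (J : ℝ)) atTop (𝓝 0) := tendsto_const_div_atTop_nhds_zero_nat _
    refine squeeze_zero' ?_ ?_ hb
    · filter_upwards [eventually_ge_atTop 2] with J hJ
      exact div_nonneg (sq_nonneg w) (edge_denom_pos hJ hw0 hw1).1.le
    · filter_upwards [eventually_ge_atTop 3] with J hJ
      have hJ' : (3 : ℝ) ≤ J := by exact_mod_cast hJ
      have hJ0 : (0 : ℝ) < J := by linarith
      have hden : (J : ℝ) ≤ (J : ℝ) * ((J : ℝ) - 1 - w) * ((J : ℝ) - 1 + w) := by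
        have h1 : (1 : ℝ) ≤ ((J : ℝ) - 1 - w) * ((J : ℝ) - 1 + w) := by nlinarith
        nlinarith
      exact div_le_div_of_nonneg_left (sq_nonneg w) hJ0 hden
  -- `A → 0`
  have hAt : Tendsto A atTop (𝓝 0) := by
    have hb : Tendsto (fun J : ℕ => 2 * w ^ 2 / (J : ℝ)) atTop (𝓝 0) :=
      tendsto_const_div_atTop_nhds_zero_nat _
    refine squeeze_zero' ?_ ?_ hb
    · filter_upwards [eventually_ge_atTop 2] with J hJ
      have hJ' : (2 : ℝ) ≤ J := by exact_mod_cast hJ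
      have hpar : 0 ≤ (1 - (-1 : ℝ) ^ J) / 2 := by
        rcases neg_one_pow_eq_or ℝ J with h | h <;> rw [h] <;> norm_num
      exact mul_nonneg hpar
        (div_nonneg (mul_nonneg (by linarith) (sq_nonneg w)) (edge_denom_pos hJ hw0 hw1).2.le)
    · filter_upwards [eventually_ge_atTop 3] with J hJ
      have hJ' : (3 : ℝ) ≤ J := by exact_mod_cast hJ
      have hJ0 : (0 : ℝ) < J := by linarith
      have hpar1 : (1 - (-1 : ℝ) ^ J) / 2 ≤ 1 := by
        rcases neg_one_pow_eq_or ℝ J with h | h <;> rw [h] <;> norm_num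
      have hD2 := (edge_denom_pos (show 2 ≤ J by omega) hw0 hw1).2
      have hq : 0 ≤ (2 * J - 1) * w ^ 2 / ((J : ℝ) ^ 2 * ((J : ℝ) - 1 - w) * ((J : ℝ) - 1 + w)) :=
        div_nonneg (mul_nonneg (by linarith) (sq_nonneg w)) hD2.le
      have hq' : (2 * J - 1) * w ^ 2 / ((J : ℝ) ^ 2 * ((J : ℝ) - 1 - w) * ((J : ℝ) - 1 + w))
          ≤ 2 * w ^ 2 / (J : ℝ) := by
        rw [div_le_div_iff₀ hD2 hJ0]
        have h1 : (1 : ℝ) ≤ ((J : ℝ) - 1 - w) * ((J : ℝ) - 1 + w) := by nlinarith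
        have hw2 : 0 ≤ w ^ 2 := sq_nonneg w
        -- (2J−1)·w²·J ≤ 2w²·J²·((J−1−w)(J−1+w))
        have hkey : (2 * (J : ℝ) - 1) * (J : ℝ) ≤ 2 * (J : ℝ) ^ 2 * (((J : ℝ) - 1 - w) * ((J : ℝ) - 1 + w)) := by
          nlinarith [mul_le_mul_of_nonneg_left h1 (by positivity : (0:ℝ) ≤ 2 * (J : ℝ) ^ 2)]
        calc (2 * (J : ℝ) - 1) * w ^ 2 * (J : ℝ) = w ^ 2 * ((2 * (J : ℝ) - 1) * (J : ℝ)) := by ring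
          _ ≤ w ^ 2 * (2 * (J : ℝ) ^ 2 * (((J : ℝ) - 1 - w) * ((J : ℝ) - 1 + w))) :=
              mul_le_mul_of_nonneg_left hkey hw2
          _ = 2 * w ^ 2 * ((J : ℝ) ^ 2 * ((J : ℝ) - 1 - w) * ((J : ℝ) - 1 + w)) := by ring
      calc A J ≤ 1 * ((2 * J - 1) * w ^ 2 / ((J : ℝ) ^ 2 * ((J : ℝ) - 1 - w) * ((J : ℝ) - 1 + w))) :=
            mul_le_mul_of_nonneg_right hpar1 hq
        _ ≤ 2 * w ^ 2 / (J : ℝ) := by rw [one_mul]; exact hq'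
  have hlim : Tendsto (fun J : ℕ => c * (1 + A J) - d * (1 + B J)) atTop (𝓝 (c - d)) := by
    have h := ((tendsto_const_nhds (x := c)).mul ((tendsto_const_nhds (x := (1:ℝ))).add hAt)).sub
      ((tendsto_const_nhds (x := d)).mul ((tendsto_const_nhds (x := (1:ℝ))).add hBt))
    simpa using h
  refine (tendsto_congr' ?_).mpr hlim
  filter_upwards [eventually_ge_atTop 2] with J hJ
  rw [formDet_edgeFamily hJ hw0 hw1]

/-- `w = ½` (the full-gap family of part 18c, now in recipe form): the limit is `−(4+π)`.
[cite: Zhang2022LandauSiegel, Prop 7.1 p.44; §2 (2.13)] -/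
theorem tendsto_formDet_edgeFamily_half :
    Tendsto (fun J : ℕ => FormDet (shiftRecipe ![1, (J : ℝ) - 1 / 2, (J : ℝ) + 1 / 2])
        (fun y => (1:ℂ) * afeDir 1 y + ((-1 : ℂ) ^ J) * afeDir J y)
        (fun y => (1:ℂ) * afeDir' 1 y + ((-1 : ℂ) ^ J) * afeDir' J y))
      atTop (𝓝 (-(4 + π))) := by
  have h := tendsto_formDet_edgeFamily (w := 1 / 2) (by norm_num) (by norm_num)
  rw [show π * (1 / 2 : ℝ) = π / 2 by ring, Real.cos_pi_div_two, Real.sin_pi_div_two] at h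
  convert h using 2
  ring

/-- `w = ¼` (the quarter-gap family of part 18d): the limit is `−4 + 2√2 − (√2/4)π` — the value part 18d's
docstring states; here a theorem. [cite: Zhang2022LandauSiegel, Prop 7.1 p.44; §2 (2.13)] -/
theorem tendsto_formDet_edgeFamily_quarter :
    Tendsto (fun J : ℕ => FormDet (shiftRecipe ![1, (J : ℝ) - 1 / 4, (J : ℝ) + 1 / 4])
        (fun y => (1:ℂ) * afeDir 1 y + ((-1 : ℂ) ^ J) * afeDir J y)
        (fun y => (1:ℂ) * afeDir' 1 y + ((-1 : ℂ) ^ J) * afeDir' J y))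
      atTop (𝓝 (-4 + 2 * Real.sqrt 2 - Real.sqrt 2 / 4 * π)) := by
  have h := tendsto_formDet_edgeFamily (w := 1 / 4) (by norm_num) (by norm_num)
  rw [show π * (1 / 4 : ℝ) = π / 4 by ring, Real.cos_pi_div_four, Real.sin_pi_div_four] at h
  convert h using 2
  ring

/-- Decimal brackets of the two limits: `−(4+π) ∈ (−7.1416, −7.14159)` and
`−4 + 2√2 − (√2/4)π ∈ (−2.2823, −2.28229)` (the «J-stable edge values» −7.1416 / −2.28229 of the numerics
lineages, cell INBOX 2026-08-27T02:07:54Z). [cite: Zhang2022LandauSiegel, Prop 7.1 p.44; §2 (2.13)] -/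
theorem edgeLimit_half_quarter_bounds :
    ((-7.1416 : ℝ) < -(4 + π) ∧ -(4 + π) < -7.14159) ∧
      ((-2.2823 : ℝ) < -4 + 2 * Real.sqrt 2 - Real.sqrt 2 / 4 * π ∧
        -4 + 2 * Real.sqrt 2 - Real.sqrt 2 / 4 * π < -2.28229) := by
  have h1 := Real.pi_gt_d20
  have h2 := Real.pi_lt_d20
  have hs2 : Real.sqrt 2 * Real.sqrt 2 = 2 := Real.mul_self_sqrt (by norm_num)
  have hs0 : 0 < Real.sqrt 2 := Real.sqrt_pos.mpr (by norm_num)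
  have hsl : (1.41421356 : ℝ) < Real.sqrt 2 := by nlinarith
  have hsu : Real.sqrt 2 < (1.41421357 : ℝ) := by nlinarith
  refine ⟨⟨by linarith, by linarith⟩, ⟨by nlinarith, by nlinarith⟩⟩

end Det

end Literature.NumberTheory.LFunctions.Zhang2022
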